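import Mathlib
import HarnessLib
import Summits.HubbardSuperconductivity.HubbardSuperconductivity.Theorems.KLProgrammeC4aPathComparability
import Summits.HubbardSuperconductivity.HubbardSuperconductivity.Theorems.KLProgrammeC4aPathRigidity
import Summits.HubbardSuperconductivity.HubbardSuperconductivity.Theorems.KLProgrammePerturbedFermiCurveHigherDerivs

/-!
# Route `KLProgramme` — crux C4a, (L3) the ORDER-ONE RADIAL ROW of the co-moving chart: the tangent of the level curve is Lipschitz in the level,
# `‖γ_ρ′(s) − γ₀′(s)‖ ≤ radialRowOneConst A (Dt_min − 2A)·|ρ|` — the `Lr` input of `norm_iteratedDeriv_pairSumPath_le_rigid` at `i = 1`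

Cell `gate-hubbard-kl`, lane hubbard-kl-c4a-1 (g5); helper for stub (C) `stub_twoLeg_curvature` of the engine-flow child `KLRegimeEngineV17F2`
(stmt-HubbardSuperconductivity-20437); memo HOME/hubbard-kl-c4a-1/C4A-PLAN.md §22.6 (α).  KEY REMARK: the angular derivative of the level-`ν` radius is a
LEVEL-FREE function of the radius, `u′(ν;s) = h_s(u(ν;s))`, `h_s(t) = −N_s(t)/D_s(t)` with `N_s(t) = ∂_θF(s,t) + t·Dδ_K(t·dir s)[dir(s+π/2)]`,
`D_s(t) = ∂_tF(s,t) + Dδ_K(t·dir s)[dir s]` (`deriv_of_isRoot`); so the radial row of `u′` is `Lip_t(h_s)·|u(μ+ρ;s) − u(μ;s)| ≤ Lip_t(h_s)·|ρ|/(Dt_min − 2A)`,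
and `Lip_t(h_s)` between two ACTUAL radii follows from `D_s ≥ Dt_min − 2A` there, `|N_s| ≤ (4+2A)π√2`, and the `t`-Lipschitz sizes of `∂_tF` (`2`,
`klrj_rayDispersionDt_lipschitz`), `∂_θF` (`4 + 2π√2`, §1), `Dδ_K` (`4A` in operator norm, from `‖D²δ_K‖ ≤ 4A`).

* §1 `abs_rayDispersionDθ_sub_le` (`|∂_θF(s,t₂) − ∂_θF(s,t₁)| ≤ (4 + 2|t₁|)|t₂ − t₁|`), `norm_fderiv_frameShift_sub_le` (`‖Dδ_K(x) − Dδ_K(y)‖ ≤ 4A‖x − y‖`),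
  `norm_toLp_frame_comb_le`;
* §2 `radialRowOneConst` (def), **`abs_deriv_frameRadius_level_sub_le`** (`|u′(μ+ρ;s) − u′(μ;s)| ≤ (…)·|ρ|`), `iteratedDeriv_one_levelPoint` (the tangent in the
  moving frame), **`norm_iteratedDeriv_one_levelPoint_sub_le`**: `‖γ_ρ′(s) − γ₀′(s)‖ ≤ radialRowOneConst A (Dt_min − 2A)·|ρ|` for `|ρ| < r` — the hypothesis `hLr` of
  `…C4aPathRigidity.norm_iteratedDeriv_pairSumPath_le_rigid` at `i = 1` with `Lr = radialRowOneConst·|ρ|`; **`norm_deriv_pairSumPath_le_rigid`** (the assembled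
  order-one rigidity bound `‖S′(0)‖ ≤ radialRowOneConst·|ρ| + msD A₃ A₄ 2·|ϑ − π|`).

Proved calculus keyed by the frame's sizes as `…C4aPathJets`; nothing about the Hubbard model's sizes; nothing asserts superconductivity.
References: BGM 2006 §2.4 Lemma 2.1 (2.40)–(2.41) [cite: BenfattoGiulianiMastropietro2006]; FST II CPAM 51 (1998) §3.
-/

noncomputable section

namespace Summit.HubbardSuperconductivity.HubbardSuperconductivity.Theorems.C4a

set_option linter.dupNamespace false -- summit = problem name (single-conjunct summit), D-0017

open Real Set MeasureTheory Finset
open scoped ContDiff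
open Literature.MathematicalPhysics.QuantumLattice Literature.MathematicalPhysics.QuantumLattice.BandSectorCounting Literature.Probability.LatticeModels
open Summit.HubbardSuperconductivity.HubbardSuperconductivity.Theorems.KLRegimeSplit
open Summit.HubbardSuperconductivity.HubbardSuperconductivity.Theorems.DispersionFlow
open Summit.HubbardSuperconductivity.HubbardSuperconductivity.Theorems.PerturbedFermiCurve

/-! ## §1 Lipschitz pieces in the radial variable -/

/-- **`∂_θF` is Lipschitz in the radius**: `|∂_θF(θ,s) − ∂_θF(θ,t)| ≤ (4 + 2|t|)·|s − t|` (`∂_θF(θ,t) = 2t·g(t)`, `|g| ≤ 2`, `g` `1`-Lipschitz). -/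
theorem abs_rayDispersionDθ_sub_le (θ s t : ℝ) : |rayDispersionDθ θ s - rayDispersionDθ θ t| ≤ (4 + 2 * |t|) * |s - t| := by
  set g : ℝ → ℝ := fun r => Real.cos θ * Real.sin (r * Real.sin θ) - Real.sin θ * Real.sin (r * Real.cos θ) with hg
  have hfun : ∀ r, rayDispersionDθ θ r = 2 * r * g r := fun r => rfl
  have hc := Real.abs_cos_le_one θ
  have hs := Real.abs_sin_le_one θ
  have hgb : |g s| ≤ 2 := by
    refine (abs_sub _ _).trans ?_
    rw [abs_mul, abs_mul]
    have := Real.abs_sin_le_one (s * Real.sin θ); have := Real.abs_sin_le_one (s * Real.cos θ)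
    nlinarith [abs_nonneg (Real.cos θ), abs_nonneg (Real.sin θ), abs_nonneg (Real.sin (s * Real.sin θ)), abs_nonneg (Real.sin (s * Real.cos θ))]
  have hgl : |g s - g t| ≤ |s - t| := by
    have h1 : |Real.sin (s * Real.sin θ) - Real.sin (t * Real.sin θ)| ≤ |Real.sin θ| * |s - t| := by
      refine (Real.abs_sin_sub_sin_le _ _).trans (le_of_eq ?_)
      rw [← sub_mul, abs_mul, mul_comm]
    have h2 : |Real.sin (s * Real.cos θ) - Real.sin (t * Real.cos θ)| ≤ |Real.cos θ| * |s - t| := by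
      refine (Real.abs_sin_sub_sin_le _ _).trans (le_of_eq ?_)
      rw [← sub_mul, abs_mul, mul_comm]
    have hsc : 2 * (|Real.sin θ| * |Real.cos θ|) ≤ 1 := by
      rw [← abs_mul, ← abs_two, ← abs_mul]
      have : 2 * (Real.sin θ * Real.cos θ) = Real.sin (2 * θ) := by rw [Real.sin_two_mul]; ring
      rw [this]; exact Real.abs_sin_le_one _
    have hsplit : g s - g t = Real.cos θ * (Real.sin (s * Real.sin θ) - Real.sin (t * Real.sin θ)) -
        Real.sin θ * (Real.sin (s * Real.cos θ) - Real.sin (t * Real.cos θ)) := by simp only [hg]; ring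
    rw [hsplit]
    refine (abs_sub _ _).trans ?_
    rw [abs_mul, abs_mul]
    have hst := abs_nonneg (s - t)
    calc |Real.cos θ| * |Real.sin (s * Real.sin θ) - Real.sin (t * Real.sin θ)| +
          |Real.sin θ| * |Real.sin (s * Real.cos θ) - Real.sin (t * Real.cos θ)|
        ≤ |Real.cos θ| * (|Real.sin θ| * |s - t|) + |Real.sin θ| * (|Real.cos θ| * |s - t|) :=
          add_le_add (mul_le_mul_of_nonneg_left h1 (abs_nonneg _)) (mul_le_mul_of_nonneg_left h2 (abs_nonneg _))
      _ = 2 * (|Real.sin θ| * |Real.cos θ|) * |s - t| := by ring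
      _ ≤ 1 * |s - t| := mul_le_mul_of_nonneg_right hsc hst
      _ = |s - t| := one_mul _
  rw [hfun, hfun]
  have hsplit : 2 * s * g s - 2 * t * g t = 2 * (s - t) * g s + 2 * t * (g s - g t) := by ring
  rw [hsplit]
  refine (abs_add_le _ _).trans ?_
  rw [abs_mul, abs_mul, abs_mul, abs_mul, abs_two]
  have hst := abs_nonneg (s - t)
  nlinarith [abs_nonneg t, abs_nonneg (g s), abs_nonneg (g s - g t)]

/-- **`Dδ_K` is `4A`-Lipschitz in operator norm** (`‖D²δ_K‖ ≤ 4A`, mean value theorem). -/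
theorem norm_fderiv_frameShift_sub_le {K : TrigPolyC4v} {A : ℝ} (hA : ∀ p : Momentum, ∀ j ≤ 2, ‖iteratedFDeriv ℝ j (frameShift K) p‖ ≤ A)
    (x y : Fin 2 → ℝ) :
    ‖fderiv ℝ (fun k : Fin 2 → ℝ => -K.eval k) x - fderiv ℝ (fun k : Fin 2 → ℝ => -K.eval k) y‖ ≤ 4 * A * ‖x - y‖ := by
  have hC2 : ContDiff ℝ 2 (fun k : Fin 2 → ℝ => -K.eval k) := by
    rw [← frameShift_toLp_eq_neg_eval]; exact contDiff_frameShift_toLp K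
  have hdiff : Differentiable ℝ (fderiv ℝ (fun k : Fin 2 → ℝ => -K.eval k)) :=
    (hC2.fderiv_right (m := 1) (by norm_num)).differentiable (by norm_num)
  have hbound : ∀ z ∈ (univ : Set (Fin 2 → ℝ)), ‖fderiv ℝ (fderiv ℝ (fun k : Fin 2 → ℝ => -K.eval k)) z‖ ≤ 4 * A := fun z _ => by
    rw [← frameShift_toLp_eq_neg_eval]; exact norm_fderiv_fderiv_frameShift_toLp_le hA z
  exact (convex_univ (𝕜 := ℝ) (E := Fin 2 → ℝ)).norm_image_sub_le_of_norm_fderiv_le (fun z _ => hdiff z) hbound (mem_univ y) (mem_univ x)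

/-- A moving-frame combination read in `Momentum`: `‖toLp(a·dir s + b·dir(s+π/2))‖ ≤ |a| + |b|`. -/
theorem norm_toLp_frame_comb_le (a b s : ℝ) : ‖(WithLp.toLp 2 (a • dir s + b • dir (s + π / 2)) : Momentum)‖ ≤ |a| + |b| := by
  rw [WithLp.toLp_add]
  exact (norm_add_le _ _).trans (by rw [norm_toLp_smul_dir, norm_toLp_smul_dir])

/-! ## §2 The order-one radial row -/

/-- **The order-one radial-row constant** (`A` the frame's `C²` size, `d = Dt_min − 2A`): with `T = π√2`, `L_N = 4 + 2T + 2A + 4AT`, `L_D = 2 + 4A`,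
`N_max = (4 + 2A)T`: `radialRowOneConst A d = (L_N/d + N_max·L_D/d²)/d + 1/d`. -/
def radialRowOneConst (A d : ℝ) : ℝ :=
  ((4 + 2 * (π * Real.sqrt 2) + 2 * A + 4 * A * (π * Real.sqrt 2)) / d + (4 + 2 * A) * (π * Real.sqrt 2) * (2 + 4 * A) / d ^ 2) / d + 1 / d

section Sizes

variable {K : TrigPolyC4v} {A : ℝ} (hA : ∀ p : Momentum, ∀ j ≤ 2, ‖iteratedFDeriv ℝ j (frameShift K) p‖ ≤ A) (hA20 : A ≤ 1 / 20)
  (hd : klCurveD ≤ (bandBounds (show (-4 : ℝ) < -1.1 by norm_num) (show (-1.1 : ℝ) ≤ -0.1 by norm_num)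
    (show (-0.1 : ℝ) < 0 by norm_num)).Dtmin - 2 * A)
  {μ r : ℝ} (hr : 0 < r) (hlo : (-1.1 : ℝ) < μ - r - A) (hhi : μ + r + A < -0.1)
  {A₃ A₄ : ℝ} (hA₃ : ∀ p : Momentum, ‖iteratedFDeriv ℝ 3 (frameShift K) p‖ ≤ A₃)
  (hA₄ : ∀ p : Momentum, ‖iteratedFDeriv ℝ 4 (frameShift K) p‖ ≤ A₄)
include hA hA20 hd hr hlo hhi hA₃ hA₄

omit hA20 hA₃ hA₄ in
/-- **The angular derivative of the radius is Lipschitz in the level**: for `|ρ| < r` and every angle `s`,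
`|u′(μ+ρ;s) − u′(μ;s)| ≤ ((L_N/d + N_max·L_D/d²)/d)·|ρ|` (`d = Dt_min − 2A`; the `1/d` summand of `radialRowOneConst` is not used here).
[cite: BenfattoGiulianiMastropietro2006, §2.4 Lemma 2.1 (2.40)–(2.41)] -/
theorem abs_deriv_frameRadius_level_sub_le {ρ : ℝ} (hρ : |ρ| < r) (s : ℝ) :
    |deriv (perturbedFermiRadius (fun k : Fin 2 → ℝ => -K.eval k) (μ + ρ)) s - deriv (perturbedFermiRadius (fun k : Fin 2 → ℝ => -K.eval k) (μ + 0)) s| ≤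
      (radialRowOneConst A ((bandBounds (show (-4 : ℝ) < -1.1 by norm_num) (show (-1.1 : ℝ) ≤ -0.1 by norm_num) (show (-0.1 : ℝ) < 0 by norm_num)).Dtmin -
          2 * A) - 1 / ((bandBounds (show (-4 : ℝ) < -1.1 by norm_num) (show (-1.1 : ℝ) ≤ -0.1 by norm_num) (show (-0.1 : ℝ) < 0 by norm_num)).Dtmin -
          2 * A)) * |ρ| := by
  set B := bandBounds (show (-4 : ℝ) < -1.1 by norm_num) (show (-1.1 : ℝ) ≤ -0.1 by norm_num) (show (-0.1 : ℝ) < 0 by norm_num) with hBdef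
  set δK : (Fin 2 → ℝ) → ℝ := fun k => -K.eval k with hδK
  set d := B.Dtmin - 2 * A with hddef
  set T := π * Real.sqrt 2 with hTdef
  have hADt : 2 * A < B.Dtmin := by have := klCurveD_pos; linarith
  have hdpos : 0 < d := by rw [hddef]; linarith
  have hA0 : 0 ≤ A := (norm_nonneg _).trans (hA 0 0 (by norm_num))
  have hT0 : 0 < T := by positivity
  -- frame data
  have hC : ContDiff ℝ 2 δK := by rw [hδK, ← frameShift_toLp_eq_neg_eval]; exact contDiff_frameShift_toLp K
  have hδ : ∀ k : Fin 2 → ℝ, (∀ i, |k i| ≤ π) → |δK k| ≤ A := fun k _ => by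
    simpa [hδK, frameShift_toLp] using abs_frameShift_toLp_le hA k
  have hκall : ∀ k : Fin 2 → ℝ, ‖fderiv ℝ δK k‖ ≤ 2 * A := fun k => by
    rw [hδK, ← frameShift_toLp_eq_neg_eval]; exact norm_fderiv_frameShift_toLp_le hA k
  have hκ : ∀ k : Fin 2 → ℝ, (∀ i, |k i| ≤ π) → ‖fderiv ℝ δK k‖ ≤ 2 * A := fun k _ => hκall k
  have hκ₂ : ∀ k : Fin 2 → ℝ, ‖fderiv ℝ (fderiv ℝ δK) k‖ ≤ 4 * A := fun k => by
    rw [hδK, ← frameShift_toLp_eq_neg_eval]; exact norm_fderiv_fderiv_frameShift_toLp_le hA k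
  -- the two levels
  have hρ1 := (abs_lt.1 hρ).1
  have hρ2 := (abs_lt.1 hρ).2
  have hl₂ : (-1.1 : ℝ) ≤ μ + ρ - A := by linarith
  have hh₂ : μ + ρ + A ≤ -0.1 := by linarith
  have hl₁ : (-1.1 : ℝ) ≤ μ + 0 - A := by linarith
  have hh₁ : μ + 0 + A ≤ -0.1 := by linarith
  have hroot₂ := isBandFermiRadius_klFermiRadius B hA hl₂ hh₂
  have hroot₁ := isBandFermiRadius_klFermiRadius B hA hl₁ hh₁
  set t₂ := perturbedFermiRadius δK (μ + ρ) s with ht₂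
  set t₁ := perturbedFermiRadius δK (μ + 0) s with ht₁
  set D₂ := rayDispersionDt s t₂ + fderiv ℝ δK (t₂ • dir s) (dir s) with hD₂
  set D₁ := rayDispersionDt s t₁ + fderiv ℝ δK (t₁ • dir s) (dir s) with hD₁
  set a₂ := fderiv ℝ δK (t₂ • dir s) (dir (s + π / 2)) with ha₂
  set a₁ := fderiv ℝ δK (t₁ • dir s) (dir (s + π / 2)) with ha₁
  set N₂ := rayDispersionDθ s t₂ + t₂ * a₂ with hN₂
  set N₁ := rayDispersionDθ s t₁ + t₁ * a₁ with hN₁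
  -- closed forms of the two derivatives
  have hder₂ : deriv (perturbedFermiRadius δK (μ + ρ)) s = -N₂ / D₂ := by
    rw [deriv_of_isRoot B hC (by norm_num) hδ hl₂ hh₂ hκ hADt hroot₂ s, hN₂, ha₂, ContinuousLinearMap.map_smul, smul_eq_mul]
  have hder₁ : deriv (perturbedFermiRadius δK (μ + 0)) s = -N₁ / D₁ := by
    rw [deriv_of_isRoot B hC (by norm_num) hδ hl₁ hh₁ hκ hADt hroot₁ s, hN₁, ha₁, ContinuousLinearMap.map_smul, smul_eq_mul]
  -- sizes at the two radii
  have hD₂d : d ≤ D₂ := Dtmin_sub_le_pertDt B hδ hl₂ hh₂ hκ hroot₂ s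
  have hD₁d : d ≤ D₁ := Dtmin_sub_le_pertDt B hδ hl₁ hh₁ hκ hroot₁ s
  have hD₂0 : 0 < D₂ := hdpos.trans_le hD₂d
  have hD₁0 : 0 < D₁ := hdpos.trans_le hD₁d
  have ht₁pos : 0 < t₁ := frameRadius_pos B hA hl₁ hh₁ s
  have ht₂pos : 0 < t₂ := frameRadius_pos B hA hl₂ hh₂ s
  have ht₁T : t₁ ≤ T := frameRadius_le B hA hl₁ hh₁ s
  have ht₁abs : |t₁| = t₁ := abs_of_pos ht₁pos
  have ha₂b : |a₂| ≤ 2 * A := abs_fderiv_dir_le (hκall _) _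
  have ha₁b : |a₁| ≤ 2 * A := abs_fderiv_dir_le (hκall _) _
  have hN₁b : |N₁| ≤ (4 + 2 * A) * T := by
    have h1 : |rayDispersionDθ s t₁| ≤ 4 * |t₁| := PerturbedFermiCurve.abs_rayDispersionDθ_le s t₁
    have h2 : |t₁ * a₁| ≤ |t₁| * (2 * A) := by rw [abs_mul]; exact mul_le_mul_of_nonneg_left ha₁b (abs_nonneg _)
    rw [ht₁abs] at h1 h2
    calc |N₁| ≤ |rayDispersionDθ s t₁| + |t₁ * a₁| := abs_add_le _ _
      _ ≤ 4 * t₁ + t₁ * (2 * A) := add_le_add h1 h2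
      _ = (4 + 2 * A) * t₁ := by ring
      _ ≤ (4 + 2 * A) * T := mul_le_mul_of_nonneg_left ht₁T (by positivity)
  -- Lipschitz sizes between the two radii
  set Δ := |t₂ - t₁| with hΔdef
  have hΔ0 : 0 ≤ Δ := abs_nonneg _
  have hΔρ : Δ ≤ |ρ| / d := by
    have h := norm_levelPoint_sub_levelPoint_le B hA hADt hlo hhi (ρ := ρ) (ρ' := 0) ⟨hρ1, hρ2⟩ ⟨by linarith, hr⟩ s
    rw [norm_levelPoint_sub_levelPoint, sub_zero] at h
    exact h
  have hDlip : |D₂ - D₁| ≤ (2 + 4 * A) * Δ := by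
    have h1 := klrj_rayDispersionDt_lipschitz s t₂ t₁
    have h2 := klrk_radial_fderiv_lipschitz hC hκ₂ (norm_dir_le_one s) t₂ t₁
    have hsplit : D₂ - D₁ = (rayDispersionDt s t₂ - rayDispersionDt s t₁) +
        (fderiv ℝ δK (t₂ • dir s) (dir s) - fderiv ℝ δK (t₁ • dir s) (dir s)) := by rw [hD₂, hD₁]; ring
    rw [hsplit]
    refine (abs_add_le _ _).trans ?_
    calc _ ≤ 2 * |t₂ - t₁| + 4 * A * |t₂ - t₁| := add_le_add h1 h2
      _ = (2 + 4 * A) * Δ := by rw [hΔdef]; ring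
  have halip : |a₂ - a₁| ≤ 4 * A * Δ := by
    have h1 : a₂ - a₁ = (fderiv ℝ δK (t₂ • dir s) - fderiv ℝ δK (t₁ • dir s)) (dir (s + π / 2)) := rfl
    rw [h1, ← Real.norm_eq_abs]
    refine (ContinuousLinearMap.le_opNorm _ _).trans ?_
    have h2 := norm_fderiv_frameShift_sub_le hA (t₂ • dir s) (t₁ • dir s)
    have h3 : ‖t₂ • dir s - t₁ • dir s‖ ≤ Δ := by
      rw [← sub_smul, norm_smul, Real.norm_eq_abs, hΔdef]
      exact mul_le_of_le_one_right (abs_nonneg _) (norm_dir_le_one s)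
    have h4 : 0 ≤ 4 * A := by positivity
    calc _ ≤ 4 * A * ‖t₂ • dir s - t₁ • dir s‖ * ‖dir (s + π / 2)‖ := mul_le_mul_of_nonneg_right h2 (norm_nonneg _)
      _ ≤ 4 * A * Δ * 1 := mul_le_mul (mul_le_mul_of_nonneg_left h3 h4) (norm_dir_le_one _) (norm_nonneg _) (by positivity)
      _ = 4 * A * Δ := mul_one _
  have hNlip : |N₂ - N₁| ≤ (4 + 2 * T + 2 * A + 4 * A * T) * Δ := by
    have h1 : |rayDispersionDθ s t₂ - rayDispersionDθ s t₁| ≤ (4 + 2 * |t₁|) * |t₂ - t₁| := abs_rayDispersionDθ_sub_le s t₂ t₁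
    rw [ht₁abs] at h1
    have h2 : |t₂ * a₂ - t₁ * a₁| ≤ 2 * A * Δ + T * (4 * A * Δ) := by
      have hsplit : t₂ * a₂ - t₁ * a₁ = (t₂ - t₁) * a₂ + t₁ * (a₂ - a₁) := by ring
      rw [hsplit]
      refine (abs_add_le _ _).trans ?_
      rw [abs_mul, abs_mul, ht₁abs]
      exact add_le_add (by rw [mul_comm]; exact mul_le_mul ha₂b le_rfl hΔ0 (by positivity))
        (mul_le_mul ht₁T halip (abs_nonneg _) hT0.le)
    have hsplit : N₂ - N₁ = (rayDispersionDθ s t₂ - rayDispersionDθ s t₁) + (t₂ * a₂ - t₁ * a₁) := by rw [hN₂, hN₁]; ring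
    rw [hsplit]
    refine (abs_add_le _ _).trans ?_
    have h3 : (4 + 2 * t₁) * |t₂ - t₁| ≤ (4 + 2 * T) * Δ := by rw [hΔdef]; exact mul_le_mul_of_nonneg_right (by linarith) (abs_nonneg _)
    calc _ ≤ (4 + 2 * T) * Δ + (2 * A * Δ + T * (4 * A * Δ)) := add_le_add (h1.trans h3) h2
      _ = (4 + 2 * T + 2 * A + 4 * A * T) * Δ := by ring
  -- the quotient
  set LN := 4 + 2 * T + 2 * A + 4 * A * T with hLN
  set LD := 2 + 4 * A with hLD
  set Nm := (4 + 2 * A) * T with hNm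
  have hLN0 : 0 ≤ LN := by positivity
  have hLD0 : 0 ≤ LD := by positivity
  have hNm0 : 0 ≤ Nm := by positivity
  have hquot : |-N₂ / D₂ - -N₁ / D₁| ≤ (LN / d + Nm * LD / d ^ 2) * Δ := by
    have heq : -N₂ / D₂ - -N₁ / D₁ = -((N₂ - N₁) * D₁ + N₁ * (D₁ - D₂)) / (D₂ * D₁) := by
      field_simp
      ring
    rw [heq, abs_div, abs_neg, abs_of_pos (mul_pos hD₂0 hD₁0), div_le_iff₀ (mul_pos hD₂0 hD₁0)]
    have hnum : |(N₂ - N₁) * D₁ + N₁ * (D₁ - D₂)| ≤ LN * Δ * D₁ + Nm * (LD * Δ) := by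
      refine (abs_add_le _ _).trans ?_
      rw [abs_mul, abs_mul, abs_of_pos hD₁0, abs_sub_comm D₁ D₂]
      exact add_le_add (mul_le_mul_of_nonneg_right hNlip hD₁0.le) (mul_le_mul hN₁b hDlip (abs_nonneg _) hNm0)
    refine hnum.trans ?_
    -- LN Δ D₁ + Nm LD Δ ≤ (LN/d + Nm LD/d²) Δ (D₂ D₁), using D₁, D₂ ≥ d
    have h1 : LN * Δ * D₁ ≤ LN / d * Δ * (D₂ * D₁) := by
      have : LN * Δ * D₁ = LN / d * Δ * (d * D₁) := by field_simp
      rw [this]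
      exact mul_le_mul_of_nonneg_left (mul_le_mul_of_nonneg_right hD₂d hD₁0.le) (by positivity)
    have h2 : Nm * (LD * Δ) ≤ Nm * LD / d ^ 2 * Δ * (D₂ * D₁) := by
      have : Nm * (LD * Δ) = Nm * LD / d ^ 2 * Δ * (d * d) := by field_simp
      rw [this]
      exact mul_le_mul_of_nonneg_left (mul_le_mul hD₂d hD₁d hdpos.le hD₂0.le) (by positivity)
    calc LN * Δ * D₁ + Nm * (LD * Δ) ≤ LN / d * Δ * (D₂ * D₁) + Nm * LD / d ^ 2 * Δ * (D₂ * D₁) := add_le_add h1 h2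
      _ = (LN / d + Nm * LD / d ^ 2) * Δ * (D₂ * D₁) := by ring
  rw [hder₂, hder₁]
  refine hquot.trans ?_
  have hcoef : 0 ≤ LN / d + Nm * LD / d ^ 2 := by positivity
  have hconst : radialRowOneConst A d - 1 / d = (LN / d + Nm * LD / d ^ 2) / d := by
    simp only [radialRowOneConst, hLN, hNm, hLD, hTdef]; ring
  rw [hconst, div_mul_eq_mul_div, le_div_iff₀ hdpos]
  calc (LN / d + Nm * LD / d ^ 2) * Δ * d ≤ (LN / d + Nm * LD / d ^ 2) * (|ρ| / d) * d :=
        mul_le_mul_of_nonneg_right (mul_le_mul_of_nonneg_left hΔρ hcoef) hdpos.le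
    _ = (LN / d + Nm * LD / d ^ 2) * |ρ| := by field_simp

omit hA20 hr hlo hhi hA₃ hA₄ in
/-- **The tangent of a level curve in the moving frame**: `γ_ρ′(s) = toLp(u′(μ+ρ;s)·dir s + u(μ+ρ;s)·dir(s+π/2))` (tube level). -/
theorem iteratedDeriv_one_levelPoint {ρ : ℝ} (hl : (-1.1 : ℝ) ≤ μ + ρ - A) (hh : μ + ρ + A ≤ -0.1) (s : ℝ) :
    iteratedDeriv 1 (levelPoint μ K ρ) s =
      WithLp.toLp 2 (deriv (perturbedFermiRadius (fun k : Fin 2 → ℝ => -K.eval k) (μ + ρ)) s • dir s +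
        perturbedFermiRadius (fun k : Fin 2 → ℝ => -K.eval k) (μ + ρ) s • dir (s + π / 2)) := by
  set B := bandBounds (show (-4 : ℝ) < -1.1 by norm_num) (show (-1.1 : ℝ) ≤ -0.1 by norm_num) (show (-0.1 : ℝ) < 0 by norm_num) with hBdef
  have hADt : 2 * A < B.Dtmin := by have := klCurveD_pos; linarith
  have hu4 : ContDiff ℝ 4 (perturbedFermiRadius (fun p : Fin 2 → ℝ => -K.eval p) (μ + ρ)) := by
    have h := contDiff_klFermiRadius B hA hADt hl hh (m := 4); exact_mod_cast h
  have hpol := hasDerivAt_polar_zero hu4 s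
  have hfun : levelPoint μ K ρ = ((EuclideanSpace.equiv (Fin 2) ℝ).symm : (Fin 2 → ℝ) →L[ℝ] Momentum) ∘
      fun t => perturbedFermiRadius (fun p : Fin 2 → ℝ => -K.eval p) (μ + ρ) t • dir t := by
    funext t; rfl
  rw [iteratedDeriv_one, hfun]
  exact (((EuclideanSpace.equiv (Fin 2) ℝ).symm : (Fin 2 → ℝ) →L[ℝ] Momentum).hasFDerivAt.comp_hasDerivAt s hpol).deriv

omit hA20 hA₃ hA₄ in
/-- **ORDER-ONE RADIAL ROW of the co-moving chart**: for `|ρ| < r` and every angle `s`, `‖γ_ρ′(s) − γ₀′(s)‖ ≤ radialRowOneConst A (Dt_min − 2A)·|ρ|` — the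
hypothesis `hLr` of `norm_iteratedDeriv_pairSumPath_le_rigid` / `…pairDiffPath_le_rigid` at `i = 1`. [cite: BenfattoGiulianiMastropietro2006, §2.4 Lemma 2.1 (2.40)–(2.41)] -/
theorem norm_iteratedDeriv_one_levelPoint_sub_le {ρ : ℝ} (hρ : |ρ| < r) (s : ℝ) :
    ‖iteratedDeriv 1 (levelPoint μ K ρ) s - iteratedDeriv 1 (levelPoint μ K 0) s‖ ≤
      radialRowOneConst A ((bandBounds (show (-4 : ℝ) < -1.1 by norm_num) (show (-1.1 : ℝ) ≤ -0.1 by norm_num) (show (-0.1 : ℝ) < 0 by norm_num)).Dtmin -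
          2 * A) * |ρ| := by
  set B := bandBounds (show (-4 : ℝ) < -1.1 by norm_num) (show (-1.1 : ℝ) ≤ -0.1 by norm_num) (show (-0.1 : ℝ) < 0 by norm_num) with hBdef
  set d := B.Dtmin - 2 * A with hddef
  have hADt : 2 * A < B.Dtmin := by have := klCurveD_pos; linarith
  have hdpos : 0 < d := by rw [hddef]; linarith
  have hρ1 := (abs_lt.1 hρ).1
  have hρ2 := (abs_lt.1 hρ).2
  have hl₂ : (-1.1 : ℝ) ≤ μ + ρ - A := by linarith
  have hh₂ : μ + ρ + A ≤ -0.1 := by linarith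
  have hl₁ : (-1.1 : ℝ) ≤ μ + 0 - A := by linarith
  have hh₁ : μ + 0 + A ≤ -0.1 := by linarith
  rw [iteratedDeriv_one_levelPoint hA hd hl₂ hh₂ s, iteratedDeriv_one_levelPoint hA hd hl₁ hh₁ s, ← WithLp.toLp_sub]
  have hsplit : deriv (perturbedFermiRadius (fun k : Fin 2 → ℝ => -K.eval k) (μ + ρ)) s • dir s +
        perturbedFermiRadius (fun k : Fin 2 → ℝ => -K.eval k) (μ + ρ) s • dir (s + π / 2) -
      (deriv (perturbedFermiRadius (fun k : Fin 2 → ℝ => -K.eval k) (μ + 0)) s • dir s +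
        perturbedFermiRadius (fun k : Fin 2 → ℝ => -K.eval k) (μ + 0) s • dir (s + π / 2)) =
      (deriv (perturbedFermiRadius (fun k : Fin 2 → ℝ => -K.eval k) (μ + ρ)) s -
          deriv (perturbedFermiRadius (fun k : Fin 2 → ℝ => -K.eval k) (μ + 0)) s) • dir s +
        (perturbedFermiRadius (fun k : Fin 2 → ℝ => -K.eval k) (μ + ρ) s -
          perturbedFermiRadius (fun k : Fin 2 → ℝ => -K.eval k) (μ + 0) s) • dir (s + π / 2) := by
    rw [sub_smul, sub_smul]; abel
  rw [hsplit]
  refine (norm_toLp_frame_comb_le _ _ _).trans ?_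
  have h1 := abs_deriv_frameRadius_level_sub_le hA hd hr hlo hhi hρ s
  have h2 : |perturbedFermiRadius (fun k : Fin 2 → ℝ => -K.eval k) (μ + ρ) s - perturbedFermiRadius (fun k : Fin 2 → ℝ => -K.eval k) (μ + 0) s| ≤
      1 / d * |ρ| := by
    have h := norm_levelPoint_sub_levelPoint_le B hA hADt hlo hhi (ρ := ρ) (ρ' := 0) ⟨hρ1, hρ2⟩ ⟨by linarith, hr⟩ s
    rw [norm_levelPoint_sub_levelPoint, sub_zero] at h
    rw [one_div_mul_eq_div]; exact h
  calc _ ≤ (radialRowOneConst A d - 1 / d) * |ρ| + 1 / d * |ρ| := add_le_add h1 h2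
    _ = radialRowOneConst A d * |ρ| := by ring

/-- **Order-one rigidity of the pair-sum path, fully discharged**: `‖S′_{ρ,ϑ,θ}(0)‖ ≤ radialRowOneConst A (Dt_min − 2A)·|ρ| + msD A₃ A₄ 2·|ϑ − π|`. -/
theorem norm_deriv_pairSumPath_le_rigid {ρ : ℝ} (hρ : |ρ| < r) (ϑ θ : ℝ) :
    ‖iteratedDeriv 1 (pairSumPath μ K ρ ϑ θ) 0‖ ≤
      radialRowOneConst A ((bandBounds (show (-4 : ℝ) < -1.1 by norm_num) (show (-1.1 : ℝ) ≤ -0.1 by norm_num) (show (-0.1 : ℝ) < 0 by norm_num)).Dtmin -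
          2 * A) * |ρ| + msD A₃ A₄ 2 * |ϑ - π| :=
  norm_iteratedDeriv_pairSumPath_le_rigid hA hA20 hd hr hlo hhi hA₃ hA₄ hρ (i := 1) (by norm_num)
    (fun s => norm_iteratedDeriv_one_levelPoint_sub_le hA hd hr hlo hhi hρ s) ϑ θ

/-- **Order-one rigidity of the pair-difference path, fully discharged** (forward configuration): `‖D′(0)‖ ≤ radialRowOneConst·|ρ| + msD A₃ A₄ 2·|ϑ|`. -/
theorem norm_deriv_pairDiffPath_le_rigid {ρ : ℝ} (hρ : |ρ| < r) (ϑ θ : ℝ) :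
    ‖iteratedDeriv 1 (pairDiffPath μ K ρ ϑ θ) 0‖ ≤
      radialRowOneConst A ((bandBounds (show (-4 : ℝ) < -1.1 by norm_num) (show (-1.1 : ℝ) ≤ -0.1 by norm_num) (show (-0.1 : ℝ) < 0 by norm_num)).Dtmin -
          2 * A) * |ρ| + msD A₃ A₄ 2 * |ϑ| :=
  norm_iteratedDeriv_pairDiffPath_le_rigid hA hA20 hd hr hlo hhi hA₃ hA₄ hρ (i := 1) (by norm_num)
    (fun s => norm_iteratedDeriv_one_levelPoint_sub_le hA hd hr hlo hhi hρ s) ϑ θ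

end Sizes

end Summit.HubbardSuperconductivity.HubbardSuperconductivity.Theorems.C4a

end
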